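import Literature.NumberTheory.Automorphic.KirillovL2BoundArch
import Literature.NumberTheory.Automorphic.ShellWhittakerGL2
import Literature.NumberTheory.Automorphic.ShellProjectorBessel
import Literature.NumberTheory.Automorphic.ShellProjectorConj
import Literature.NumberTheory.Automorphic.CuspidalWhittakerGL2
import Literature.NumberTheory.Automorphic.GlobalAdditiveCharacterProofs
import HarnessLib

/-!
# The Kirillov `L²`-bound for `GL_2`: finite places (shell sums along the torus at the bad places)

Topic `NumberTheory/Automorphic`; namespace `Literature.NumberTheory.Automorphic`. Proof file for
the `n ≤ 2` case of the named fact `JacquetShalika1981_partialPairL_pole_of_eq_conj` (theorems; the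
only definitions are the explicit torus products `torusShellProd` and the bound predicate
`KirillovL2Bound`, both with bodies).

`KirillovL2BoundArch` bounds `∫_{K_∞ˣ} |W_{S_θ f}(a(y))|² d^×y` by finitely many archimedean Sobolev
norms `‖S_{θ_u} f‖²` for `θ` of finite level `U`. Here the bound is extended to the sum over the
shells `a_v(ϖ_v^{m_v})`, `m ∈ ℤ^T`, at any finite set `T` of finite places (`KirillovL2Bound T`):

  `∑_{m ∈ ℤ^T} ∫_{K_∞ˣ} |W_{S_θ f}(a(y) ∏_{v∈T} ι_v(a(ϖ_v^{m_v})))|² d^×y ≤ C ∑_{u ∈ 𝒰} ‖S_{θ_u} f‖²`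
  (`exists_kirillovL2Bound`),

with `C < ∞` and the finite set of words `𝒰` depending only on `T` and the level `U`. The place step
(`kirillovL2Bound_insert`): translate `θ` by `ι_v(a(ϖ^k))`; the shells `k ≤ d_v - 1 - N₀` vanish
(`whittakerCoeff_eq_zero_of_upper_invariant`); for the others the shell smoothing `e_J ⋆` of
`ShellSmoothingGL2` restores a level independent of `k` and changes nothing in the Whittaker
coefficient at elements trivial at `v` (`norm_sq_whittakerCoeff_le_shell`), while on smoothed
vectors it acts as the conjugated shell projectors, which satisfy Bessel's inequality over `k`
(`ShellProjectorBessel`). The constant is multiplied by `4` at each place and the words do not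
change (Jacquet–Shalika (1981), §5, where this is the square-integrability of local Kirillov functions,
obtained there from the local theory).

## References

* H. Jacquet, J. A. Shalika, *On Euler products and the classification of automorphic
  representations I*, Amer. J. Math. 103 (1981), §4–§5 [JacquetShalikaAJM1981].
* D. Bump, *Automorphic Forms and Representations*, CUP (1997), §2.8, §4.4 [Bump1997].
-/

noncomputable section

open scoped MatrixGroups Classical ENNReal NNReal ComplexConjugate
open WithZero NumberField NumberField.mixedEmbedding NumberField.InfinitePlace IsDedekindDomain MeasureTheory
open Literature.Analysis.UnboundedOperators

namespace Literature.NumberTheory.Automorphic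

open ShellGL2

variable {K : Type} [Field K] [NumberField K]
  {μ : Measure (AdelicGroupData.gl 2 K).automorphicQuotient} [(AdelicGroupData.gl 2 K).IsAutomorphicMeasure μ]

attribute [local instance] adelicBorel borelSpace_adelic locallyCompactSpace_adelic
  secondCountableTopology_gl_adelic

attribute [local instance] Literature.MeasureTheory.Group.Units.borelSpace_of_isOpenEmbedding
  Literature.MeasureTheory.Group.hasSummableGeomSeries_of_finiteDimensional

set_option backward.isDefEq.respectTransparency false
set_option synthInstance.maxHeartbeats 400000

/-! ### Elements trivial at a finite place -/

section Trivial

variable {v : HeightOneSpectrum (𝓞 K)}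

/-- Archimedean elements are trivial at every finite place. [folklore] -/
private theorem toLocalAt_ofInfinite_eq_one (x : GL (Fin 2) (mixedSpace K)) : GLn.toLocalAt 2 K v (GLn.ofInfinite 2 K x) = 1 := by
  refine Matrix.GeneralLinearGroup.ext fun i j => ?_
  rw [GLn.toLocalAt_apply, AdelicGroupData.gl_toLocal]
  change AdelicGroupData.adeleEval K v ((GLn.ofInfinite 2 K x : Matrix (Fin 2) (Fin 2) (AdeleRing (𝓞 K) K)) i j) =
    (1 : Matrix (Fin 2) (Fin 2) (v.adicCompletion K)) i j
  rw [AdelicGroupData.adeleEval_apply, GLn.coe_ofInfinite_apply]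
  change ((1 : Matrix (Fin 2) (Fin 2) (FiniteAdeleRing (𝓞 K) K)) i j) v = _
  rw [Matrix.one_apply, Matrix.one_apply]
  split_ifs <;> rfl

/-- `a(y) = (diag(y,1), 1)` is trivial at `v`. [folklore] -/
theorem toLocalAt_archDilation (y : (mixedSpace K)ˣ) : GLn.toLocalAt 2 K v (archDilationAdelic K y) = 1 :=
  toLocalAt_ofInfinite_eq_one _

/-- `ι_w(x)` is trivial at `v ≠ w`. [folklore] -/
theorem toLocalAt_ofLocal_of_ne {w : HeightOneSpectrum (𝓞 K)} (h : v ≠ w) (x : GL (Fin 2) (w.adicCompletion K)) :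
    GLn.toLocalAt 2 K v (GLn.ofLocal 2 K w x) = 1 :=
  GLn.toLocal_ofLocal_of_ne h x

end Trivial

/-! ### The torus products over a finite set of places -/

section Torus

variable (ϖ : ∀ v : HeightOneSpectrum (𝓞 K), (v.adicCompletion K)ˣ)

/-- The torus element `a_v(t) = ι_v(diag(t, 1)) ∈ GL_2(𝔸_K)`. [folklore] -/
def torusAt (v : HeightOneSpectrum (𝓞 K)) (t : (v.adicCompletion K)ˣ) : GL (Fin 2) (AdeleRing (𝓞 K) K) :=
  GLn.ofLocal 2 K v (glDiagonal 2 (v.adicCompletion K) ![t, 1])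

/-- Torus elements at distinct places commute. [folklore] -/
theorem commute_torusAt {v w : HeightOneSpectrum (𝓞 K)} (h : v ≠ w) (t : (v.adicCompletion K)ˣ) (s : (w.adicCompletion K)ˣ) :
    Commute (torusAt v t) (torusAt w s) :=
  GLn.ofLocal_mul_eq_mul_ofLocal_of_toLocal_eq_one _ (GLn.toLocal_ofLocal_of_ne h _)

/-- Extension of a shell index `m ∈ ℤ^T` by zero to all places. [folklore] -/
def extendShell {T : Finset (HeightOneSpectrum (𝓞 K))} (m : ↥T → ℤ) (v : HeightOneSpectrum (𝓞 K)) : ℤ :=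
  if h : v ∈ T then m ⟨v, h⟩ else 0

omit [NumberField K] in
/-- Auxiliary. [folklore] -/
theorem extendShell_of_mem {T : Finset (HeightOneSpectrum (𝓞 K))} (m : ↥T → ℤ) {v : HeightOneSpectrum (𝓞 K)} (h : v ∈ T) :
    extendShell m v = m ⟨v, h⟩ := dif_pos h

/-- **The torus shell product** `∏_{v ∈ T} ι_v(a(ϖ_v^{m_v}))` for `m ∈ ℤ^T`. [folklore] -/
def torusShellProd (T : Finset (HeightOneSpectrum (𝓞 K))) (m : ↥T → ℤ) : GL (Fin 2) (AdeleRing (𝓞 K) K) :=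
  T.noncommProd (fun v => torusAt v (ϖ v ^ extendShell m v)) fun _ _ _ _ hvw => commute_torusAt hvw _ _

/-- The empty product. [folklore] -/
theorem torusShellProd_empty (m : ↥(∅ : Finset (HeightOneSpectrum (𝓞 K))) → ℤ) : torusShellProd ϖ ∅ m = 1 := by
  simp [torusShellProd]

/-- The torus shell product is trivial at the places outside `T`. [folklore] -/
theorem toLocalAt_torusShellProd {T : Finset (HeightOneSpectrum (𝓞 K))} {v : HeightOneSpectrum (𝓞 K)} (hv : v ∉ T) (m : ↥T → ℤ) :
    GLn.toLocalAt 2 K v (torusShellProd ϖ T m) = 1 := by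
  unfold torusShellProd
  rw [Finset.map_noncommProd]
  refine (Finset.noncommProd_eq_pow_card _ _ _ 1 fun w hw => ?_).trans (one_pow _)
  exact GLn.toLocal_ofLocal_of_ne (fun h => hv (by rw [h]; exact hw)) _

/-- Inserting a place: `∏_{insert v T} = ι_v(a(ϖ_v^{m_v})) · ∏_T`. [folklore] -/
theorem torusShellProd_insert {T : Finset (HeightOneSpectrum (𝓞 K))} {v : HeightOneSpectrum (𝓞 K)} (hv : v ∉ T)
    (m : ↥(insert v T) → ℤ) :
    torusShellProd ϖ (insert v T) m =
      torusAt v (ϖ v ^ m ⟨v, Finset.mem_insert_self v T⟩) * torusShellProd ϖ T (fun w => m ⟨w.1, Finset.mem_insert_of_mem w.2⟩) := by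
  unfold torusShellProd
  rw [Finset.noncommProd_insert_of_notMem _ _ _ _ hv, extendShell_of_mem m (Finset.mem_insert_self v T)]
  congr 1
  refine Finset.noncommProd_congr rfl (fun w hw => ?_) _
  rw [extendShell_of_mem m (Finset.mem_insert_of_mem hw), extendShell_of_mem _ hw]

end Torus

/-! ### Local group theory: torus conjugates of congruence subgroups and unipotents -/

section LocalGroup

variable {v : HeightOneSpectrum (𝓞 K)}

local notation "𝐧" => (Matrix.GeneralLinearGroup.upperRightHom : AddChar (v.adicCompletion K) (GL (Fin 2) (v.adicCompletion K)))
local notation "𝐚" t:max => glDiagonal 2 (v.adicCompletion K) ![t, 1]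

/-- `n(z) ∈ K_v(e^{-N₀})` for `|z| ≤ e^{-N₀}`. [folklore] -/
theorem upperRightHom_mem_localCongruenceSubgroup {N₀ : ℕ} {z : v.adicCompletion K} (hz : Valued.v z ≤ exp (-(N₀ : ℤ))) :
    (𝐧 z : GL (Fin 2) (v.adicCompletion K)) ∈ localCongruenceSubgroup 2 K v N₀ := by
  have hle1 : exp (-(N₀ : ℤ)) ≤ (1 : WithZero (Multiplicative ℤ)) := by rw [← exp_zero, exp_le_exp]; omega
  have hz1 : Valued.v z ≤ 1 := hz.trans hle1
  have key : ∀ {y : v.adicCompletion K}, Valued.v y ≤ 1 → ∀ i j, Valued.v (ent (𝐧 y) i j) ≤ 1 := by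
    intro y hy i j
    obtain ⟨e00, e01, e10, e11⟩ := ent_n y
    fin_cases i <;> fin_cases j
    · show Valued.v (ent (𝐧 y) 0 0) ≤ 1
      rw [e00, Valuation.map_one]
    · show Valued.v (ent (𝐧 y) 0 1) ≤ 1
      rw [e01]; exact hy
    · show Valued.v (ent (𝐧 y) 1 0) ≤ 1
      rw [e10, Valuation.map_zero]; exact zero_le
    · show Valued.v (ent (𝐧 y) 1 1) ≤ 1
      rw [e11, Valuation.map_one]
  refine ⟨key hz1, ?_, fun i j => ?_⟩
  · rw [← AddChar.map_neg_eq_inv]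
    exact key (by rw [Valuation.map_neg]; exact hz1)
  · obtain ⟨e00, e01, e10, e11⟩ := ent_n z
    rw [Matrix.sub_apply]
    fin_cases i <;> fin_cases j
    · show Valued.v (ent (𝐧 z) 0 0 - (1 : Matrix (Fin 2) (Fin 2) (v.adicCompletion K)) 0 0) ≤ _
      rw [e00, Matrix.one_apply_eq, sub_self, Valuation.map_zero]; exact zero_le
    · show Valued.v (ent (𝐧 z) 0 1 - (1 : Matrix (Fin 2) (Fin 2) (v.adicCompletion K)) 0 1) ≤ _
      rw [e01, Matrix.one_apply_ne (by decide), sub_zero]; exact hz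
    · show Valued.v (ent (𝐧 z) 1 0 - (1 : Matrix (Fin 2) (Fin 2) (v.adicCompletion K)) 1 0) ≤ _
      rw [e10, Matrix.one_apply_ne (by decide), sub_zero, Valuation.map_zero]; exact zero_le
    · show Valued.v (ent (𝐧 z) 1 1 - (1 : Matrix (Fin 2) (Fin 2) (v.adicCompletion K)) 1 1) ≤ _
      rw [e11, Matrix.one_apply_eq, sub_self, Valuation.map_zero]; exact zero_le

/-- **Torus conjugates of congruence subgroups**: for `k' ∈ K_v(e^{-M})`, `|t| = e^{-k}` and
`M ≥ N₀ + |k|`, the entries of `a(t)⁻¹ k' a(t) - 1` are `≤ e^{-N₀}`. [folklore] -/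
theorem valued_aInv_conj_sub_one_le {M N₀ : ℕ} {k : ℤ} (hM : (N₀ : ℤ) + |k| ≤ M) {t : (v.adicCompletion K)ˣ}
    (ht : Valued.v (t : v.adicCompletion K) = exp (-k)) {k' : GL (Fin 2) (v.adicCompletion K)} (hk' : k' ∈ localCongruenceSubgroup 2 K v M)
    (i j : Fin 2) : Valued.v ((((𝐚 t)⁻¹ * k' * 𝐚 t : GL (Fin 2) (v.adicCompletion K)) : Matrix (Fin 2) (Fin 2) (v.adicCompletion K)) i j -
      (1 : Matrix (Fin 2) (Fin 2) (v.adicCompletion K)) i j) ≤ exp (-(N₀ : ℤ)) := by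
  obtain ⟨-, -, h⟩ := hk'
  obtain ⟨e00, e01, e10, e11⟩ := ent_aInv_mul_mul_a t k'
  have h' : ∀ i j, Valued.v (ent k' i j - (1 : Matrix (Fin 2) (Fin 2) (v.adicCompletion K)) i j) ≤ exp (-(M : ℤ)) := fun i j => by
    have := h i j; rwa [Matrix.sub_apply] at this
  have hti : Valued.v (((t⁻¹ : (v.adicCompletion K)ˣ) : v.adicCompletion K)) = exp k := by
    rw [Units.val_inv_eq_inv_val, map_inv₀, ht, ← exp_neg, neg_neg]
  have habs := abs_nonneg k
  have hk1 := le_abs_self k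
  have hk2 := neg_abs_le k
  fin_cases i <;> fin_cases j
  · show Valued.v (ent ((𝐚 t)⁻¹ * k' * 𝐚 t) 0 0 - _) ≤ _
    rw [e00]; exact (h' 0 0).trans (exp_le_exp.2 (by omega))
  · show Valued.v (ent ((𝐚 t)⁻¹ * k' * 𝐚 t) 0 1 - (1 : Matrix (Fin 2) (Fin 2) (v.adicCompletion K)) 0 1) ≤ _
    rw [e01, Matrix.one_apply_ne (by decide), sub_zero, map_mul, hti]
    have h01 := h' 0 1
    rw [Matrix.one_apply_ne (by decide), sub_zero] at h01
    calc exp k * Valued.v (ent k' 0 1) ≤ exp k * exp (-(M : ℤ)) := mul_le_mul_right h01 _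
      _ ≤ exp (-(N₀ : ℤ)) := by rw [← exp_add, exp_le_exp]; omega
  · show Valued.v (ent ((𝐚 t)⁻¹ * k' * 𝐚 t) 1 0 - (1 : Matrix (Fin 2) (Fin 2) (v.adicCompletion K)) 1 0) ≤ _
    rw [e10, Matrix.one_apply_ne (by decide), sub_zero, map_mul, ht]
    have h10 := h' 1 0
    rw [Matrix.one_apply_ne (by decide), sub_zero] at h10
    calc Valued.v (ent k' 1 0) * exp (-k) ≤ exp (-(M : ℤ)) * exp (-k) := mul_le_mul_left h10 _
      _ ≤ exp (-(N₀ : ℤ)) := by rw [← exp_add, exp_le_exp]; omega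
  · show Valued.v (ent ((𝐚 t)⁻¹ * k' * 𝐚 t) 1 1 - _) ≤ _
    rw [e11]; exact (h' 1 1).trans (exp_le_exp.2 (by omega))

/-- **Torus conjugates of congruence subgroups**: `a(t)⁻¹ K_v(e^{-M}) a(t) ≤ K_v(e^{-N₀})` for `|t| = e^{-k}`,
`M ≥ N₀ + |k|`. [folklore] -/
theorem aInv_conj_mem_localCongruenceSubgroup {M N₀ : ℕ} {k : ℤ} (hM : (N₀ : ℤ) + |k| ≤ M) {t : (v.adicCompletion K)ˣ}
    (ht : Valued.v (t : v.adicCompletion K) = exp (-k)) {k' : GL (Fin 2) (v.adicCompletion K)} (hk' : k' ∈ localCongruenceSubgroup 2 K v M) :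
    (𝐚 t)⁻¹ * k' * 𝐚 t ∈ localCongruenceSubgroup 2 K v N₀ := by
  have hle1 : exp (-(N₀ : ℤ)) ≤ (1 : WithZero (Multiplicative ℤ)) := by rw [← exp_zero, exp_le_exp]; omega
  -- entries of `g` from those of `g - 1`
  have ent_le : ∀ {g : GL (Fin 2) (v.adicCompletion K)},
      (∀ i j, Valued.v (((g : GL (Fin 2) (v.adicCompletion K)) : Matrix (Fin 2) (Fin 2) (v.adicCompletion K)) i j -
        (1 : Matrix (Fin 2) (Fin 2) (v.adicCompletion K)) i j) ≤ exp (-(N₀ : ℤ))) →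
      ∀ i j, Valued.v (((g : GL (Fin 2) (v.adicCompletion K)) : Matrix (Fin 2) (Fin 2) (v.adicCompletion K)) i j) ≤ 1 := by
    intro g hg i j
    have e : ((g : GL (Fin 2) (v.adicCompletion K)) : Matrix (Fin 2) (Fin 2) (v.adicCompletion K)) i j =
        (((g : GL (Fin 2) (v.adicCompletion K)) : Matrix (Fin 2) (Fin 2) (v.adicCompletion K)) i j - (1 : Matrix (Fin 2) (Fin 2) (v.adicCompletion K)) i j) +
          (1 : Matrix (Fin 2) (Fin 2) (v.adicCompletion K)) i j := by rw [sub_add_cancel]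
    rw [e]
    refine v_add_le ((hg i j).trans hle1) ?_
    rw [Matrix.one_apply]; split_ifs <;> simp
  have h1 := valued_aInv_conj_sub_one_le (v := v) hM ht hk'
  have h2 := valued_aInv_conj_sub_one_le (v := v) hM ht ((localCongruenceSubgroup 2 K v M).inv_mem hk')
  refine ⟨ent_le h1, ?_, fun i j => by rw [Matrix.sub_apply]; exact h1 i j⟩
  have einv : ((𝐚 t)⁻¹ * k' * 𝐚 t)⁻¹ = (𝐚 t)⁻¹ * k'⁻¹ * 𝐚 t := by group
  rw [einv]
  exact ent_le h2

end LocalGroup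

/-! ### The torus translates of a level-`U` weight at `v` -/

section Translate

variable {v : HeightOneSpectrum (𝓞 K)}

local notation "𝐧" => (Matrix.GeneralLinearGroup.upperRightHom : AddChar (v.adicCompletion K) (GL (Fin 2) (v.adicCompletion K)))
local notation "𝐚" t:max => glDiagonal 2 (v.adicCompletion K) ![t, 1]

variable {U : Subgroup (GL (Fin 2) (FiniteAdeleRing (𝓞 K) K))} {N₀ : ℕ}
  (hU0 : (localCongruenceSubgroup 2 K v N₀).map (ofLocalFinite K v) ≤ U)
  {θ' : GL (Fin 2) (AdeleRing (𝓞 K) K) → ℝ} (hθ'U : ∀ u ∈ U, ∀ g : GL (Fin 2) (AdeleRing (𝓞 K) K), θ' (GLn.ofFinite 2 K u * g) = θ' g)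

include hU0 hθ'U in
/-- A level-`U` weight is left `ι_v(K_v(e^{-N₀}))`-invariant when `U ⊇ ι_v^∞(K_v(e^{-N₀}))`. [folklore] -/
theorem apply_toAdelic_mul_of_mem_localCongruenceSubgroup {x : GL (Fin 2) (v.adicCompletion K)} (hx : x ∈ localCongruenceSubgroup 2 K v N₀)
    (h : (AdelicGroupData.gl 2 K).Adelic) : θ' (GLn.toAdelic 2 K v x * h) = θ' h := by
  have hmem : ofLocalFinite K v x ∈ U := hU0 ⟨x, hx, rfl⟩
  have e : GLn.toAdelic 2 K v x = (GLn.ofFinite 2 K (ofLocalFinite K v x) : (AdelicGroupData.gl 2 K).Adelic) := (ofFinite_ofLocalFinite K v x).symm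
  rw [e]
  exact hθ'U _ hmem h

omit [(AdelicGroupData.gl 2 K).IsAutomorphicMeasure μ] in
/-- The basic rewriting: `(L_{ι(a)} θ')(ι(x) h) = θ'(ι(a⁻¹ x a) (ι(a)⁻¹ h))`. [folklore] -/
theorem leftTranslateWeight_toAdelic_apply_toAdelic_mul (θ' : GL (Fin 2) (AdeleRing (𝓞 K) K) → ℝ) (a x : GL (Fin 2) (v.adicCompletion K))
    (h : (AdelicGroupData.gl 2 K).Adelic) :
    leftTranslateWeight (n := 2) (GLn.toAdelic 2 K v a) θ' (GLn.toAdelic 2 K v x * h) =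
      θ' (GLn.toAdelic 2 K v (a⁻¹ * x * a) * ((GLn.toAdelic 2 K v a)⁻¹ * h)) := by
  rw [leftTranslateWeight_apply]
  congr 1
  simp only [map_mul, map_inv, mul_assoc, mul_inv_cancel_left]

include hθ'U in
/-- The torus translate is left invariant under the `(1,U)`-elements trivial at `v`. [folklore] -/
theorem leftTranslateWeight_toAdelic_ofFinite_mul (a : GL (Fin 2) (v.adicCompletion K)) :
    ∀ u ∈ U, GLn.toLocalAt 2 K v (GLn.ofFinite 2 K u) = 1 → ∀ g : GL (Fin 2) (AdeleRing (𝓞 K) K),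
      leftTranslateWeight (n := 2) (GLn.toAdelic 2 K v a) θ' (GLn.ofFinite 2 K u * g) = leftTranslateWeight (n := 2) (GLn.toAdelic 2 K v a) θ' g := by
  intro u hu hu1 g
  rw [leftTranslateWeight_apply, leftTranslateWeight_apply]
  set uA : (AdelicGroupData.gl 2 K).Adelic := GLn.ofFinite 2 K u with huA
  set gA : (AdelicGroupData.gl 2 K).Adelic := g with hgA
  have hc : (GLn.toAdelic 2 K v a)⁻¹ * uA = uA * (GLn.toAdelic 2 K v a)⁻¹ := by
    rw [← map_inv]; exact GLn.toAdelic_mul_eq_mul_toAdelic hu1 _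
  show θ' ((GLn.toAdelic 2 K v a)⁻¹ * (uA * gA)) = θ' ((GLn.toAdelic 2 K v a)⁻¹ * gA)
  rw [← mul_assoc, hc, mul_assoc]
  exact hθ'U u hu _

include hU0 hθ'U in
/-- **Discretisation level of the torus translate**: `L_{ι(a(t))} θ'` is left `ι_v(K_v(e^{-N}))`-invariant
when `N ≥ N₀ + |k|`, `|t| = e^{-k}`. [folklore] -/
theorem isLeftKvInvariant_leftTranslateWeight_torus (D : ShellDatum K v) {k : ℤ} (hN : (N₀ : ℤ) + |k| ≤ D.N) {t : (v.adicCompletion K)ˣ}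
    (ht : Valued.v (t : v.adicCompletion K) = exp (-k)) :
    D.IsLeftKvInvariant (leftTranslateWeight (n := 2) (GLn.toAdelic 2 K v (𝐚 t)) θ') := by
  intro x hx h
  rw [leftTranslateWeight_toAdelic_apply_toAdelic_mul, apply_toAdelic_mul_of_mem_localCongruenceSubgroup hU0 hθ'U (aInv_conj_mem_localCongruenceSubgroup hN ht hx),
    leftTranslateWeight_apply]

include hU0 hθ'U in
/-- **Lower-triangular invariance of the torus translate** on the shells `k ≥ -r - N₀` (`c ≥ 2 N₀`). [folklore] -/
theorem isLeftLowerInvariant_leftTranslateWeight_torus (D : ShellDatum K v) (hcc : 2 * (N₀ : ℤ) ≤ D.c) {k : ℤ} (hk : -D.r - N₀ ≤ k)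
    {t : (v.adicCompletion K)ˣ} (ht : Valued.v (t : v.adicCompletion K) = exp (-k)) :
    D.IsLeftLowerInvariant (leftTranslateWeight (n := 2) (GLn.toAdelic 2 K v (𝐚 t)) θ') := by
  intro b hb hb01 h
  have hmem : (𝐚 t)⁻¹ * b * 𝐚 t ∈ localCongruenceSubgroup 2 K v N₀ :=
    aInv_mul_mul_a_mem_valuedCongruenceSubgroup D.hc hcc (Nat.cast_nonneg N₀) hk hb01 hb.1 hb.2.1 hb.2.2.2 ht.le
  rw [leftTranslateWeight_toAdelic_apply_toAdelic_mul, apply_toAdelic_mul_of_mem_localCongruenceSubgroup hU0 hθ'U hmem, leftTranslateWeight_apply]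

include hU0 hθ'U in
/-- **Upper-unipotent invariance of the torus translate** on the shells `k ≤ d - 1 - N₀`: for `y` with
`|t⁻¹ y| ≤ e^{-N₀}`, `L_{ι(a(t))} θ'` is left `ι_v(n(y))`-invariant. [folklore] -/
theorem leftTranslateWeight_torus_upper_invariant {t : (v.adicCompletion K)ˣ} {y : v.adicCompletion K}
    (hy : Valued.v (((t⁻¹ : (v.adicCompletion K)ˣ) : v.adicCompletion K) * y) ≤ exp (-(N₀ : ℤ))) (h : (AdelicGroupData.gl 2 K).Adelic) :
    leftTranslateWeight (n := 2) (GLn.toAdelic 2 K v (𝐚 t)) θ' (GLn.toAdelic 2 K v (𝐧 y) * h) =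
      leftTranslateWeight (n := 2) (GLn.toAdelic 2 K v (𝐚 t)) θ' h := by
  rw [leftTranslateWeight_toAdelic_apply_toAdelic_mul, aInv_mul_n_mul_a,
    apply_toAdelic_mul_of_mem_localCongruenceSubgroup hU0 hθ'U (upperRightHom_mem_localCongruenceSubgroup hy), leftTranslateWeight_apply]

end Translate

/-! ### The bound predicate -/

section Predicate

variable [MeasurableSpace (GL (Fin 2) (AdeleRing (𝓞 K) K))] [BorelSpace (GL (Fin 2) (AdeleRing (𝓞 K) K))]

variable (μ) in
/-- **The Kirillov `L²`-bound at the places `T` for the level `U`** with constant `C` and words `𝒰`: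
for every closed subrepresentation `W ≤ L²`, every test function `θ` left `(1,U)`-invariant and every
`f ∈ W`, the shell sum over `m ∈ ℤ^T` of `∫_{K_∞ˣ} |W_{S_θ f}(a(y) ∏_{v∈T} ι_v(a(ϖ_v^{m_v})))|² d^×y`
is at most `C ∑_{u∈𝒰} ‖S_{θ_u} f‖²`. [cite: JacquetShalikaAJM1981, §5] -/
def KirillovL2Bound (ν₀ : Measure ↥(adelicUnipotent 2 K)) (ϖ : ∀ v : HeightOneSpectrum (𝓞 K), (v.adicCompletion K)ˣ)
    (T : Finset (HeightOneSpectrum (𝓞 K))) (U : Subgroup (GL (Fin 2) (FiniteAdeleRing (𝓞 K) K))) (C : ℝ≥0∞)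
    (𝒰 : Finset (List (AutomorphyDatum.gl 2 K (isCompact_glFiniteIntegralLevel_holds 2 K)).arch.lie)) : Prop :=
  ∀ (W : ContRepresentation.ClosedSubrep ((AdelicGroupData.gl 2 K).rightRegular μ))
    (θ : GL (Fin 2) (AdeleRing (𝓞 K) K) → ℝ), IsTestFunctionGL 2 K θ →
    (∀ u ∈ U, ∀ g : GL (Fin 2) (AdeleRing (𝓞 K) K), θ (GLn.ofFinite 2 K u * g) = θ g) → ∀ f : W.toSubmodule,
      ∑' m : ↥T → ℤ, ∫⁻ y, ‖whittakerCoeff ν₀ (unipotentTateDomain 2 K) (adeleAddChar K)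
          (invQuot (AdelicGroupData.gl 2 K) (smoothedForm θ (f : (AdelicGroupData.gl 2 K).L2 μ)))
          (archDilationGL K y * torusShellProd ϖ T m)‖ₑ ^ 2 ∂mixedUnitsHaar K ≤
        C * ∑ u ∈ 𝒰, ENNReal.ofReal (‖(smoothedVector W
          (wordDerivWeight (AutomorphyDatum.gl 2 K (isCompact_glFiniteIntegralLevel_holds 2 K)).ofArch u θ) f :
            (AdelicGroupData.gl 2 K).L2 μ)‖ ^ 2)

/-- **Base case**: the archimedean bound of `KirillovL2BoundArch` is the bound at `T = ∅`. [folklore] -/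
theorem kirillovL2Bound_empty (ν₀ : Measure ↥(adelicUnipotent 2 K)) [Measure.IsHaarMeasure ν₀]
    (ϖ : ∀ v : HeightOneSpectrum (𝓞 K), (v.adicCompletion K)ˣ)
    (U : Subgroup (GL (Fin 2) (FiniteAdeleRing (𝓞 K) K))) (hUo : IsOpen (U : Set (GL (Fin 2) (FiniteAdeleRing (𝓞 K) K))))
    (hUc : IsCompact (U : Set (GL (Fin 2) (FiniteAdeleRing (𝓞 K) K)))) :
    ∃ (C : ℝ≥0∞) (_ : C ≠ ⊤) (𝒰 : Finset (List (AutomorphyDatum.gl 2 K (isCompact_glFiniteIntegralLevel_holds 2 K)).arch.lie)),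
      KirillovL2Bound μ ν₀ ϖ ∅ U C 𝒰 := by
  obtain ⟨C, hC, 𝒰, h⟩ := exists_lintegral_norm_sq_whittakerCoeff_archDilation_le (μ := μ) ν₀ U hUo hUc
  refine ⟨C, hC, 𝒰, fun W θ hθ hθU f => ?_⟩
  rw [tsum_eq_single (fun _ => 0) (fun m hm => absurd (funext fun w => absurd w.2 (Finset.notMem_empty _)) hm)]
  simp only [torusShellProd_empty, mul_one]
  exact h W θ hθ hθU f

end Predicate

/-! ### Derivatives and level of the words -/

section Words

variable {U : Subgroup (GL (Fin 2) (FiniteAdeleRing (𝓞 K) K))}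

omit [(AdelicGroupData.gl 2 K).IsAutomorphicMeasure μ] in
/-- `(1,u)` has trivial archimedean component. [folklore] -/
theorem toMixed_ofFinite (u : GL (Fin 2) (FiniteAdeleRing (𝓞 K) K)) : GLn.toMixed 2 K (GLn.ofFinite 2 K u) = 1 := by
  rw [GLn.toMixed_apply, GLn.fstHom_ofFinite, map_one]

/-- **Left `(1,U)`-invariance passes to archimedean word derivatives.** [folklore] -/
theorem wordDerivWeight_ofFinite_mul (hcpt : isCompact_glFiniteIntegralLevel 2 K) {θ : GL (Fin 2) (AdeleRing (𝓞 K) K) → ℝ}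
    (hθ : IsTestFunctionGL 2 K θ) (hθU : ∀ u ∈ U, ∀ g : GL (Fin 2) (AdeleRing (𝓞 K) K), θ (GLn.ofFinite 2 K u * g) = θ g)
    (w : List (AutomorphyDatum.gl 2 K hcpt).arch.lie) :
    ∀ u ∈ U, ∀ g : GL (Fin 2) (AdeleRing (𝓞 K) K),
      wordDerivWeight (AutomorphyDatum.gl 2 K hcpt).ofArch w θ (GLn.ofFinite 2 K u * g) = wordDerivWeight (AutomorphyDatum.gl 2 K hcpt).ofArch w θ g := by
  intro u hu g
  set uA : (AdelicGroupData.gl 2 K).Adelic := GLn.ofFinite 2 K u with huA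
  have hL : leftTranslateWeight (n := 2) uA⁻¹ θ = θ := by
    funext h
    rw [leftTranslateWeight_apply, inv_inv]
    exact hθU u hu h
  have h1 : GLn.toMixed 2 K uA⁻¹ = 1 := by rw [map_inv, huA, toMixed_ofFinite, inv_one]
  have h := wordDerivWeight_leftTranslateWeight_of_toMixed_eq_one hcpt hθ h1 w
  rw [hL] at h
  have h' := congrFun h g
  rw [leftTranslateWeight_apply, inv_inv] at h'
  exact h'.symm

end Words

/-! ### The estimate on one shell -/

section Shell

variable [MeasurableSpace (GL (Fin 2) (AdeleRing (𝓞 K) K))] [BorelSpace (GL (Fin 2) (AdeleRing (𝓞 K) K))]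
variable {v : HeightOneSpectrum (𝓞 K)} [MeasurableSpace (GL (Fin 2) (v.adicCompletion K))] [BorelSpace (GL (Fin 2) (v.adicCompletion K))]

local notation "𝐚" t:max => glDiagonal 2 (v.adicCompletion K) ![t, 1]

/-- Measurability in `y` of the squared Whittaker coefficient of a smoothed form along the torus. [folklore] -/
theorem measurable_enorm_sq_whittakerCoeff_archDilation (ν₀ : Measure ↥(adelicUnipotent 2 K)) [Measure.IsHaarMeasure ν₀]
    {θ : GL (Fin 2) (AdeleRing (𝓞 K) K) → ℝ} (hθ : IsTestFunctionGL 2 K θ) (f : (AdelicGroupData.gl 2 K).L2 μ) (g : GL (Fin 2) (AdeleRing (𝓞 K) K)) :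
    Measurable fun y : (mixedSpace K)ˣ => ‖whittakerCoeff ν₀ (unipotentTateDomain 2 K) (adeleAddChar K)
      (invQuot (AdelicGroupData.gl 2 K) (smoothedForm θ f)) (archDilationGL K y * g)‖ₑ ^ 2 := by
  have hψc : Continuous (adeleAddChar K) := (isGlobalAddChar_adeleAddChar (K := K)).continuous
  have hW := continuous_whittakerCoeff (ν := ν₀) measurableSet_unipotentTateDomain isCompact_closure_unipotentTateDomain hψc
    (continuous_invQuot_smoothedForm (μ := μ) hθ.continuous hθ.hasCompactSupport f)
  exact ((hW.comp ((continuous_archDilationAdelic (K := K)).mul continuous_const)).measurable.enorm.pow_const _)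

set_option maxHeartbeats 2000000 in
/-- **The estimate on one shell.** Let `D` be a shell datum at `v` with `c ≥ 2 N₀`, `U ⊇ ι_v^∞(K_v(e^{-N₀}))`,
`N'` an admissible level `≥ N₀`, and suppose the Kirillov bound holds at the places `T ∌ v` for the level
`U ⊓ K_v(e^{-N'})` with constant `C` and words `𝒰`. Then for a level-`U` test function `θ`, `f ∈ W` and a
shell `k ≥ -r - N₀` with `N₀ + |k| ≤ D.N` (torus element `t`, `|t| = e^{-k}`), the shell sum at `T` of the
translate `L_{ι_v(a(t))} θ` is bounded by `2 C ∑_u (‖E (π(a(t)) x_u)‖² + ‖Ē (π(a(t)) x_u)‖²)`,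
`x_u = S_{θ_u} f`. [cite: JacquetShalikaAJM1981, §5] -/
theorem shell_estimate (ν₀ : Measure ↥(adelicUnipotent 2 K)) [Measure.IsHaarMeasure ν₀]
    (ϖ : ∀ w : HeightOneSpectrum (𝓞 K), (w.adicCompletion K)ˣ) {T : Finset (HeightOneSpectrum (𝓞 K))} (hv : v ∉ T)
    {U : Subgroup (GL (Fin 2) (FiniteAdeleRing (𝓞 K) K))} {N₀ : ℕ} (hU0 : (localCongruenceSubgroup 2 K v N₀).map (ofLocalFinite K v) ≤ U)
    (D : ShellDatum K v) (hcc : 2 * (N₀ : ℤ) ≤ D.c) {N' : ℕ} (hN' : D.LevelOK N') (hN'0 : N₀ ≤ N')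
    {C : ℝ≥0∞} {𝒰 : Finset (List (AutomorphyDatum.gl 2 K (isCompact_glFiniteIntegralLevel_holds 2 K)).arch.lie)}
    (hIH : KirillovL2Bound μ ν₀ ϖ T (levelInfAt K v U N') C 𝒰)
    (W : ContRepresentation.ClosedSubrep ((AdelicGroupData.gl 2 K).rightRegular μ)) {θ : GL (Fin 2) (AdeleRing (𝓞 K) K) → ℝ}
    (hθ : IsTestFunctionGL 2 K θ) (hθU : ∀ u ∈ U, ∀ g : GL (Fin 2) (AdeleRing (𝓞 K) K), θ (GLn.ofFinite 2 K u * g) = θ g) (f : W.toSubmodule)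
    {k : ℤ} (hk : -D.r - N₀ ≤ k) (hDN : (N₀ : ℤ) + |k| ≤ D.N) {t : (v.adicCompletion K)ˣ} (ht : Valued.v (t : v.adicCompletion K) = exp (-k)) :
    ∑' m : ↥T → ℤ, ∫⁻ y, ‖whittakerCoeff ν₀ (unipotentTateDomain 2 K) (adeleAddChar K)
        (invQuot (AdelicGroupData.gl 2 K) (smoothedForm (leftTranslateWeight (n := 2) (GLn.toAdelic 2 K v (𝐚 t)) θ)
          (f : (AdelicGroupData.gl 2 K).L2 μ))) (archDilationGL K y * torusShellProd ϖ T m)‖ₑ ^ 2 ∂mixedUnitsHaar K ≤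
      2 * C * ∑ u ∈ 𝒰,
        (ENNReal.ofReal (‖twistedAverage D.J D.isCompact_J (localRightRegular K v μ) (shellChar K v)
            (localRightRegular K v μ (𝐚 t) (smoothedVector W (wordDerivWeight
              (AutomorphyDatum.gl 2 K (isCompact_glFiniteIntegralLevel_holds 2 K)).ofArch u θ) f : (AdelicGroupData.gl 2 K).L2 μ))‖ ^ 2) +
          ENNReal.ofReal (‖twistedAverage D.J D.isCompact_J (localRightRegular K v μ) (fun j => conj (shellChar K v j))
            (localRightRegular K v μ (𝐚 t) (smoothedVector W (wordDerivWeight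
              (AutomorphyDatum.gl 2 K (isCompact_glFiniteIntegralLevel_holds 2 K)).ofArch u θ) f : (AdelicGroupData.gl 2 K).L2 μ))‖ ^ 2)) := by
  have hc₀ : isCompact_glFiniteIntegralLevel 2 K := isCompact_glFiniteIntegralLevel_holds 2 K
  set a : GL (Fin 2) (v.adicCompletion K) := 𝐚 t with ha
  set θk : GL (Fin 2) (AdeleRing (𝓞 K) K) → ℝ := leftTranslateWeight (n := 2) (GLn.toAdelic 2 K v a) θ with hθk_def
  have hθk : IsTestFunctionGL 2 K θk := hθ.leftTranslate _
  have hθkU : ∀ u ∈ U, GLn.toLocalAt 2 K v (GLn.ofFinite 2 K u) = 1 → ∀ g : GL (Fin 2) (AdeleRing (𝓞 K) K), θk (GLn.ofFinite 2 K u * g) = θk g :=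
    leftTranslateWeight_toAdelic_ofFinite_mul hθU a
  have hθK : D.IsLeftKvInvariant θk := isLeftKvInvariant_leftTranslateWeight_torus hU0 hθU D hDN ht
  have hθB : D.IsLeftLowerInvariant θk := isLeftLowerInvariant_leftTranslateWeight_torus hU0 hθU D hcc hk ht
  have hKU : (localCongruenceSubgroup 2 K v N').map (ofLocalFinite K v) ≤ U :=
    (Subgroup.map_mono (localCongruenceSubgroup_antitone 2 K v hN'0)).trans hU0
  -- the shell weights and their level
  set θ₁ := D.shellRe θk with hθ₁
  set θ₂ := D.shellIm θk with hθ₂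
  have hθ₁t : IsTestFunctionGL 2 K θ₁ := D.isTestFunctionGL_shellRe hθk
  have hθ₂t : IsTestFunctionGL 2 K θ₂ := D.isTestFunctionGL_shellIm hθk
  have hθ₁U := D.shellRe_ofFinite_mul hN' hKU hθk.continuous hθK hθkU
  have hθ₂U := D.shellIm_ofFinite_mul hN' hKU hθk.continuous hθK hθkU
  have I₁ := hIH W θ₁ hθ₁t hθ₁U f
  have I₂ := hIH W θ₂ hθ₂t hθ₂U f
  -- pointwise comparison along the torus
  have hpt : ∀ (m : ↥T → ℤ) (y : (mixedSpace K)ˣ),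
      ‖whittakerCoeff ν₀ (unipotentTateDomain 2 K) (adeleAddChar K) (invQuot (AdelicGroupData.gl 2 K) (smoothedForm θk (f : (AdelicGroupData.gl 2 K).L2 μ)))
          (archDilationGL K y * torusShellProd ϖ T m)‖ₑ ^ 2 ≤
        2 * ‖whittakerCoeff ν₀ (unipotentTateDomain 2 K) (adeleAddChar K) (invQuot (AdelicGroupData.gl 2 K) (smoothedForm θ₁ (f : (AdelicGroupData.gl 2 K).L2 μ)))
            (archDilationGL K y * torusShellProd ϖ T m)‖ₑ ^ 2 +
          2 * ‖whittakerCoeff ν₀ (unipotentTateDomain 2 K) (adeleAddChar K) (invQuot (AdelicGroupData.gl 2 K) (smoothedForm θ₂ (f : (AdelicGroupData.gl 2 K).L2 μ)))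
            (archDilationGL K y * torusShellProd ϖ T m)‖ₑ ^ 2 := by
    intro m y
    have hg : GLn.toLocalAt 2 K v (archDilationGL K y * torusShellProd ϖ T m) = 1 := by
      rw [GLn.toLocalAt_apply, map_mul, ← GLn.toLocalAt_apply, ← GLn.toLocalAt_apply, archDilationGL, toLocalAt_archDilation,
        toLocalAt_torusShellProd ϖ hv, one_mul]
    have h := D.norm_sq_whittakerCoeff_le_shell ν₀ hθk hθB (f : (AdelicGroupData.gl 2 K).L2 μ) hg
    simp only [← ofReal_norm, ← ENNReal.ofReal_pow (norm_nonneg _)]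
    calc _ ≤ ENNReal.ofReal (2 * _ + 2 * _) := ENNReal.ofReal_le_ofReal h
      _ = _ := by
        rw [ENNReal.ofReal_add (by positivity) (by positivity), ENNReal.ofReal_mul zero_le_two, ENNReal.ofReal_mul zero_le_two, ENNReal.ofReal_ofNat]
  -- integrate and sum
  have hmeas : ∀ (θ' : GL (Fin 2) (AdeleRing (𝓞 K) K) → ℝ), IsTestFunctionGL 2 K θ' → ∀ m : ↥T → ℤ,
      Measurable fun y : (mixedSpace K)ˣ => 2 * ‖whittakerCoeff ν₀ (unipotentTateDomain 2 K) (adeleAddChar K)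
        (invQuot (AdelicGroupData.gl 2 K) (smoothedForm θ' (f : (AdelicGroupData.gl 2 K).L2 μ))) (archDilationGL K y * torusShellProd ϖ T m)‖ₑ ^ 2 :=
    fun θ' hθ' m => (measurable_enorm_sq_whittakerCoeff_archDilation ν₀ hθ' _ _).const_mul _
  have step1 : ∑' m : ↥T → ℤ, ∫⁻ y, ‖whittakerCoeff ν₀ (unipotentTateDomain 2 K) (adeleAddChar K)
        (invQuot (AdelicGroupData.gl 2 K) (smoothedForm θk (f : (AdelicGroupData.gl 2 K).L2 μ))) (archDilationGL K y * torusShellProd ϖ T m)‖ₑ ^ 2 ∂mixedUnitsHaar K ≤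
      2 * (∑' m : ↥T → ℤ, ∫⁻ y, ‖whittakerCoeff ν₀ (unipotentTateDomain 2 K) (adeleAddChar K)
        (invQuot (AdelicGroupData.gl 2 K) (smoothedForm θ₁ (f : (AdelicGroupData.gl 2 K).L2 μ))) (archDilationGL K y * torusShellProd ϖ T m)‖ₑ ^ 2 ∂mixedUnitsHaar K) +
      2 * (∑' m : ↥T → ℤ, ∫⁻ y, ‖whittakerCoeff ν₀ (unipotentTateDomain 2 K) (adeleAddChar K)
        (invQuot (AdelicGroupData.gl 2 K) (smoothedForm θ₂ (f : (AdelicGroupData.gl 2 K).L2 μ))) (archDilationGL K y * torusShellProd ϖ T m)‖ₑ ^ 2 ∂mixedUnitsHaar K) := by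
    rw [← ENNReal.tsum_mul_left, ← ENNReal.tsum_mul_left, ← ENNReal.tsum_add]
    refine ENNReal.tsum_le_tsum fun m => ?_
    rw [← lintegral_const_mul _ (measurable_enorm_sq_whittakerCoeff_archDilation ν₀ hθ₁t _ _),
      ← lintegral_const_mul _ (measurable_enorm_sq_whittakerCoeff_archDilation ν₀ hθ₂t _ _), ← lintegral_add_left (hmeas θ₁ hθ₁t m)]
    exact lintegral_mono fun y => hpt m y
  refine step1.trans ?_
  -- the word norms
  have hθu : ∀ u : List (AutomorphyDatum.gl 2 K hc₀).arch.lie, IsTestFunctionGL 2 K (wordDerivWeight (AutomorphyDatum.gl 2 K hc₀).ofArch u θ) :=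
    fun u => isTestFunctionGL_wordDerivWeight' hc₀ hθ u
  have hθuU : ∀ u : List (AutomorphyDatum.gl 2 K hc₀).arch.lie, ∀ u' ∈ U, ∀ g : GL (Fin 2) (AdeleRing (𝓞 K) K),
      wordDerivWeight (AutomorphyDatum.gl 2 K hc₀).ofArch u θ (GLn.ofFinite 2 K u' * g) = wordDerivWeight (AutomorphyDatum.gl 2 K hc₀).ofArch u θ g :=
    fun u => wordDerivWeight_ofFinite_mul hc₀ hθ hθU u
  have hnorm : ∀ u : List (AutomorphyDatum.gl 2 K hc₀).arch.lie,
      ENNReal.ofReal (‖(smoothedVector W (wordDerivWeight (AutomorphyDatum.gl 2 K hc₀).ofArch u θ₁) f : (AdelicGroupData.gl 2 K).L2 μ)‖ ^ 2) +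
        ENNReal.ofReal (‖(smoothedVector W (wordDerivWeight (AutomorphyDatum.gl 2 K hc₀).ofArch u θ₂) f : (AdelicGroupData.gl 2 K).L2 μ)‖ ^ 2) ≤
      ENNReal.ofReal (‖twistedAverage D.J D.isCompact_J (localRightRegular K v μ) (shellChar K v)
            (localRightRegular K v μ a (smoothedVector W (wordDerivWeight (AutomorphyDatum.gl 2 K hc₀).ofArch u θ) f : (AdelicGroupData.gl 2 K).L2 μ))‖ ^ 2) +
        ENNReal.ofReal (‖twistedAverage D.J D.isCompact_J (localRightRegular K v μ) (fun j => conj (shellChar K v j))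
            (localRightRegular K v μ a (smoothedVector W (wordDerivWeight (AutomorphyDatum.gl 2 K hc₀).ofArch u θ) f : (AdelicGroupData.gl 2 K).L2 μ))‖ ^ 2) := by
    intro u
    -- `(θ_i)_u = Re/Im (e_J ⋆ L_a (θ_u))`
    have e₁ : wordDerivWeight (AutomorphyDatum.gl 2 K hc₀).ofArch u θ₁ = D.shellRe (leftTranslateWeight (n := 2) (GLn.toAdelic 2 K v a)
        (wordDerivWeight (AutomorphyDatum.gl 2 K hc₀).ofArch u θ)) := by
      rw [hθ₁, D.wordDerivWeight_shellRe hc₀ hθk u, hθk_def, wordDerivWeight_leftTranslateWeight_of_toMixed_eq_one hc₀ hθ (GLn.toMixed_toAdelic a) u]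
    have e₂ : wordDerivWeight (AutomorphyDatum.gl 2 K hc₀).ofArch u θ₂ = D.shellIm (leftTranslateWeight (n := 2) (GLn.toAdelic 2 K v a)
        (wordDerivWeight (AutomorphyDatum.gl 2 K hc₀).ofArch u θ)) := by
      rw [hθ₂, D.wordDerivWeight_shellIm hc₀ hθk u, hθk_def, wordDerivWeight_leftTranslateWeight_of_toMixed_eq_one hc₀ hθ (GLn.toMixed_toAdelic a) u]
    have hθuK : D.IsLeftKvInvariant (leftTranslateWeight (n := 2) (GLn.toAdelic 2 K v a) (wordDerivWeight (AutomorphyDatum.gl 2 K hc₀).ofArch u θ)) :=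
      isLeftKvInvariant_leftTranslateWeight_torus hU0 (hθuU u) D hDN ht
    obtain ⟨hRe, hIm⟩ := D.norm_sq_smoothedVector_shellRe_le_and_shellIm_le W ((hθu u).leftTranslate _) hθuK f
    have ew : (smoothedVector W (leftTranslateWeight (n := 2) (GLn.toAdelic 2 K v a) (wordDerivWeight (AutomorphyDatum.gl 2 K hc₀).ofArch u θ)) f :
        (AdelicGroupData.gl 2 K).L2 μ) = localRightRegular K v μ a (smoothedVector W (wordDerivWeight (AutomorphyDatum.gl 2 K hc₀).ofArch u θ) f : (AdelicGroupData.gl 2 K).L2 μ) := by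
      rw [localRightRegular_apply]; exact coe_smoothedVector_leftTranslate W (hθu u).continuous (hθu u).hasCompactSupport f _
    rw [e₁, e₂, ← ENNReal.ofReal_add (sq_nonneg _) (sq_nonneg _), ← ENNReal.ofReal_add (sq_nonneg _) (sq_nonneg _)]
    refine ENNReal.ofReal_le_ofReal ?_
    rw [ew] at hRe hIm
    linarith
  -- assemble
  have hsum : ∑ u ∈ 𝒰, (ENNReal.ofReal (‖(smoothedVector W (wordDerivWeight (AutomorphyDatum.gl 2 K hc₀).ofArch u θ₁) f : (AdelicGroupData.gl 2 K).L2 μ)‖ ^ 2) +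
          ENNReal.ofReal (‖(smoothedVector W (wordDerivWeight (AutomorphyDatum.gl 2 K hc₀).ofArch u θ₂) f : (AdelicGroupData.gl 2 K).L2 μ)‖ ^ 2)) ≤
      ∑ u ∈ 𝒰, (ENNReal.ofReal (‖twistedAverage D.J D.isCompact_J (localRightRegular K v μ) (shellChar K v)
            (localRightRegular K v μ a (smoothedVector W (wordDerivWeight (AutomorphyDatum.gl 2 K hc₀).ofArch u θ) f : (AdelicGroupData.gl 2 K).L2 μ))‖ ^ 2) +
        ENNReal.ofReal (‖twistedAverage D.J D.isCompact_J (localRightRegular K v μ) (fun j => conj (shellChar K v j))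
            (localRightRegular K v μ a (smoothedVector W (wordDerivWeight (AutomorphyDatum.gl 2 K hc₀).ofArch u θ) f : (AdelicGroupData.gl 2 K).L2 μ))‖ ^ 2)) :=
    Finset.sum_le_sum fun u _ => hnorm u
  calc _ ≤ 2 * (C * ∑ u ∈ 𝒰, ENNReal.ofReal (‖(smoothedVector W (wordDerivWeight (AutomorphyDatum.gl 2 K hc₀).ofArch u θ₁) f : (AdelicGroupData.gl 2 K).L2 μ)‖ ^ 2)) +
        2 * (C * ∑ u ∈ 𝒰, ENNReal.ofReal (‖(smoothedVector W (wordDerivWeight (AutomorphyDatum.gl 2 K hc₀).ofArch u θ₂) f : (AdelicGroupData.gl 2 K).L2 μ)‖ ^ 2)) :=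
        add_le_add (mul_le_mul' le_rfl I₁) (mul_le_mul' le_rfl I₂)
    _ = 2 * C * ∑ u ∈ 𝒰, (ENNReal.ofReal (‖(smoothedVector W (wordDerivWeight (AutomorphyDatum.gl 2 K hc₀).ofArch u θ₁) f : (AdelicGroupData.gl 2 K).L2 μ)‖ ^ 2) +
          ENNReal.ofReal (‖(smoothedVector W (wordDerivWeight (AutomorphyDatum.gl 2 K hc₀).ofArch u θ₂) f : (AdelicGroupData.gl 2 K).L2 μ)‖ ^ 2)) := by
        rw [Finset.sum_add_distrib, mul_add, mul_assoc, mul_assoc]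
    _ ≤ _ := mul_le_mul' le_rfl hsum

end Shell

/-! ### The place step -/

section Step

variable [MeasurableSpace (GL (Fin 2) (AdeleRing (𝓞 K) K))] [BorelSpace (GL (Fin 2) (AdeleRing (𝓞 K) K))]
variable {v : HeightOneSpectrum (𝓞 K)}

local notation "𝐚" t:max => glDiagonal 2 (v.adicCompletion K) ![t, 1]

/-- Changing the discretisation level of a shell datum. [folklore] -/
def ShellDatum.atLevel (D : ShellDatum K v) (M : ℕ) (hM : D.N ≤ M) : ShellDatum K v :=
  ⟨D.r, D.c, D.hc, M, (ShellDatum.LevelOK.mono D D.levelOK_N hM).1, (ShellDatum.LevelOK.mono D D.levelOK_N hM).2.1, (ShellDatum.LevelOK.mono D D.levelOK_N hM).2.2.1, (ShellDatum.LevelOK.mono D D.levelOK_N hM).2.2.2, D.hψ⟩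

/-- The equivalence `ℤ × ℤ^T ≃ ℤ^{T ∪ {v}}` used to split off the shell at `v`. [folklore] -/
def insertShellEquiv {T : Finset (HeightOneSpectrum (𝓞 K))} (hv : v ∉ T) : ℤ × (↥T → ℤ) ≃ (↥(insert v T) → ℤ) where
  toFun p w := if h : w.1 = v then p.1 else p.2 ⟨w.1, (Finset.mem_insert.1 w.2).resolve_left h⟩
  invFun m := (m ⟨v, Finset.mem_insert_self v T⟩, fun w => m ⟨w.1, Finset.mem_insert_of_mem w.2⟩)
  left_inv p := by
    rcases p with ⟨k, m'⟩
    refine Prod.ext (dif_pos rfl) (funext fun w => ?_)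
    have hw : (w : HeightOneSpectrum (𝓞 K)) ≠ v := fun h => hv (h ▸ w.2)
    exact dif_neg hw
  right_inv m := by
    funext w
    by_cases h : (w : HeightOneSpectrum (𝓞 K)) = v
    · simp only [dif_pos h]
      congr 1
      exact Subtype.ext h.symm
    · simp only [dif_neg h]

omit [MeasurableSpace (GL (Fin 2) (AdeleRing (𝓞 K) K))] [BorelSpace (GL (Fin 2) (AdeleRing (𝓞 K) K))] [(AdelicGroupData.gl 2 K).IsAutomorphicMeasure μ] in
omit [NumberField K] in
/-- Auxiliary. [folklore] -/
theorem insertShellEquiv_apply_self {T : Finset (HeightOneSpectrum (𝓞 K))} (hv : v ∉ T) (p : ℤ × (↥T → ℤ)) :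
    insertShellEquiv hv p ⟨v, Finset.mem_insert_self v T⟩ = p.1 := dif_pos rfl

omit [MeasurableSpace (GL (Fin 2) (AdeleRing (𝓞 K) K))] [BorelSpace (GL (Fin 2) (AdeleRing (𝓞 K) K))] [(AdelicGroupData.gl 2 K).IsAutomorphicMeasure μ] in
omit [NumberField K] in
/-- Auxiliary. [folklore] -/
theorem insertShellEquiv_apply_of_mem {T : Finset (HeightOneSpectrum (𝓞 K))} (hv : v ∉ T) (p : ℤ × (↥T → ℤ)) (w : ↥T) :
    insertShellEquiv hv p ⟨w.1, Finset.mem_insert_of_mem w.2⟩ = p.2 w := by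
  have hw : (w : HeightOneSpectrum (𝓞 K)) ≠ v := fun h => hv (h ▸ w.2)
  show (if h : (w : HeightOneSpectrum (𝓞 K)) = v then p.1 else p.2 ⟨w.1, _⟩) = p.2 w
  rw [dif_neg hw]

/-- A `tsum` in `ℝ≥0∞` of `ofReal`s is bounded by `ofReal c` when all finite sums are `≤ c`. [folklore] -/
theorem _root_.ENNReal.tsum_ofReal_le_of_sum_le {ι : Type*} {a : ι → ℝ} {c : ℝ} (ha : ∀ i, 0 ≤ a i) (h : ∀ s : Finset ι, ∑ i ∈ s, a i ≤ c) :
    ∑' i, ENNReal.ofReal (a i) ≤ ENNReal.ofReal c := by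
  rw [ENNReal.tsum_eq_iSup_sum]
  refine iSup_le fun s => ?_
  rw [← ENNReal.ofReal_sum_of_nonneg fun i _ => ha i]
  exact ENNReal.ofReal_le_ofReal (h s)

set_option maxHeartbeats 4000000 in
/-- **The place step.** Let `v ∉ T`, `U ⊇ ι_v^∞(K_v(e^{-N₀}))`, `ψ_v` of conductor exponent `d`, `ϖ_v` a
uniformizer, `r = 1 - d`, `c = max(1, 2N₀)`, `N'` an admissible level `≥ N₀`, and suppose the Kirillov bound
holds at `T` for the level `U ⊓ K_v(e^{-N'})` with constant `C` and words `𝒰`. Then it holds at `T ∪ {v}`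
for the level `U` with constant `4C` and the same words. [cite: JacquetShalikaAJM1981, §5] -/
theorem kirillovL2Bound_insert (ν₀ : Measure ↥(adelicUnipotent 2 K)) [Measure.IsHaarMeasure ν₀]
    (ϖ : ∀ w : HeightOneSpectrum (𝓞 K), (w.adicCompletion K)ˣ) (hϖ : Valued.v ((ϖ v : (v.adicCompletion K)ˣ) : v.adicCompletion K) = exp (-1 : ℤ))
    {T : Finset (HeightOneSpectrum (𝓞 K))} (hv : v ∉ T)
    {U : Subgroup (GL (Fin 2) (FiniteAdeleRing (𝓞 K) K))} {N₀ : ℕ} (hU0 : (localCongruenceSubgroup 2 K v N₀).map (ofLocalFinite K v) ≤ U)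
    {d : ℤ} (hd : ((adeleAddChar K).adicComponent v).HasConductorExp d)
    (D₀ : ShellDatum K v) (hr : D₀.r = 1 - d) (hcc : 2 * (N₀ : ℤ) ≤ D₀.c) (hN'0 : N₀ ≤ D₀.N)
    {C : ℝ≥0∞} {𝒰 : Finset (List (AutomorphyDatum.gl 2 K (isCompact_glFiniteIntegralLevel_holds 2 K)).arch.lie)}
    (hIH : KirillovL2Bound μ ν₀ ϖ T (levelInfAt K v U D₀.N) C 𝒰) :
    KirillovL2Bound μ ν₀ ϖ (insert v T) U (4 * C) 𝒰 := by
  have hc₀ : isCompact_glFiniteIntegralLevel 2 K := isCompact_glFiniteIntegralLevel_holds 2 K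
  letI : MeasurableSpace (GL (Fin 2) (v.adicCompletion K)) := borel _
  haveI : BorelSpace (GL (Fin 2) (v.adicCompletion K)) := ⟨rfl⟩
  intro W θ hθ hθU f
  -- the non-trivial element of `𝔭^{d-1} = 𝔭^{-r}`
  obtain ⟨x₀, hx₀m, hx₀ψ⟩ := hd.2
  have hx₀ : Valued.v x₀ ≤ exp D₀.r := by
    rw [hr, show (1 : ℤ) - d = -(d - 1) by ring]; exact (mem_primePowBall_adicCompletion_iff (v := v)).1 hx₀m
  -- notation
  set Φ : (GL (Fin 2) (AdeleRing (𝓞 K) K) → ℝ) → GL (Fin 2) (AdeleRing (𝓞 K) K) → ℝ≥0∞ := fun θ' g =>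
    ‖whittakerCoeff ν₀ (unipotentTateDomain 2 K) (adeleAddChar K) (invQuot (AdelicGroupData.gl 2 K) (smoothedForm θ' (f : (AdelicGroupData.gl 2 K).L2 μ))) g‖ₑ ^ 2 with hΦ
  set θk : ℤ → GL (Fin 2) (AdeleRing (𝓞 K) K) → ℝ := fun k => leftTranslateWeight (n := 2) (GLn.toAdelic 2 K v (𝐚 (ϖ v ^ k))) θ with hθk
  set x : List (AutomorphyDatum.gl 2 K hc₀).arch.lie → (AdelicGroupData.gl 2 K).L2 μ := fun u =>
    (smoothedVector W (wordDerivWeight (AutomorphyDatum.gl 2 K hc₀).ofArch u θ) f : (AdelicGroupData.gl 2 K).L2 μ) with hx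
  set A : ℤ → List (AutomorphyDatum.gl 2 K hc₀).arch.lie → ℝ := fun k u =>
    ‖twistedAverage D₀.J D₀.isCompact_J (localRightRegular K v μ) (shellChar K v) (localRightRegular K v μ (𝐚 (ϖ v ^ k)) (x u))‖ ^ 2 with hA
  set B : ℤ → List (AutomorphyDatum.gl 2 K hc₀).arch.lie → ℝ := fun k u =>
    ‖twistedAverage D₀.J D₀.isCompact_J (localRightRegular K v μ) (fun j => conj (shellChar K v j)) (localRightRegular K v μ (𝐚 (ϖ v ^ k)) (x u))‖ ^ 2 with hB
  -- Step 1: split off the shell at `v`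
  have hsplit : ∑' m : ↥(insert v T) → ℤ, ∫⁻ y, Φ θ (archDilationGL K y * torusShellProd ϖ (insert v T) m) ∂mixedUnitsHaar K =
      ∑' k : ℤ, ∑' m' : ↥T → ℤ, ∫⁻ y, Φ (θk k) (archDilationGL K y * torusShellProd ϖ T m') ∂mixedUnitsHaar K := by
    rw [← Equiv.tsum_eq (insertShellEquiv hv), ENNReal.tsum_prod']
    refine tsum_congr fun k => tsum_congr fun m' => lintegral_congr fun y => ?_
    have e1 : torusShellProd ϖ (insert v T) (insertShellEquiv hv (k, m')) = torusAt v (ϖ v ^ k) * torusShellProd ϖ T m' := by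
      rw [torusShellProd_insert ϖ hv, insertShellEquiv_apply_self]
      congr 2
      funext w
      exact insertShellEquiv_apply_of_mem hv (k, m') w
    have e2 : torusAt v (ϖ v ^ k) * torusShellProd ϖ T m' = torusShellProd ϖ T m' * torusAt v (ϖ v ^ k) :=
      GLn.ofLocal_mul_eq_mul_ofLocal_of_toLocal_eq_one _ (toLocalAt_torusShellProd ϖ hv m')
    simp only [hΦ]
    rw [e1, e2, ← mul_assoc]
    exact congrArg (fun z : ℂ => ‖z‖ₑ ^ 2)
      (whittakerCoeff_invQuot_smoothedForm_mul ν₀ (unipotentTateDomain 2 K) (adeleAddChar K) θ (f : (AdelicGroupData.gl 2 K).L2 μ)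
        (archDilationGL K y * torusShellProd ϖ T m') (GLn.toAdelic 2 K v (𝐚 (ϖ v ^ k))))
  rw [hsplit]
  -- Step 2: the bound on each shell
  set k₀ : ℤ := -D₀.r - N₀ with hk₀
  have hshell : ∀ k : ℤ, ∑' m' : ↥T → ℤ, ∫⁻ y, Φ (θk k) (archDilationGL K y * torusShellProd ϖ T m') ∂mixedUnitsHaar K ≤
      2 * C * ∑ u ∈ 𝒰, (ENNReal.ofReal (A k u) + ENNReal.ofReal (B k u)) := by
    intro k
    by_cases hlt : k < k₀
    · -- vanishing shells
      have hy : Valued.v ((((ϖ v ^ k)⁻¹ : (v.adicCompletion K)ˣ) : v.adicCompletion K) * x₀) ≤ exp (-(N₀ : ℤ)) := by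
        rw [map_mul, Units.val_inv_eq_inv_val, map_inv₀, valued_zpow_uniformizer hϖ, ← exp_neg, neg_neg]
        calc exp k * Valued.v x₀ ≤ exp k * exp D₀.r := mul_le_mul_right hx₀ _
          _ ≤ exp (-(N₀ : ℤ)) := by rw [← exp_add, exp_le_exp]; omega
      have hzero : ∀ (m' : ↥T → ℤ) (y : (mixedSpace K)ˣ), Φ (θk k) (archDilationGL K y * torusShellProd ϖ T m') = 0 := by
        intro m' y
        have hg : GLn.toLocalAt 2 K v (archDilationGL K y * torusShellProd ϖ T m') = 1 := by
          rw [GLn.toLocalAt_apply, map_mul, ← GLn.toLocalAt_apply, ← GLn.toLocalAt_apply, archDilationGL, toLocalAt_archDilation,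
            toLocalAt_torusShellProd ϖ hv, one_mul]
        simp only [hΦ, hθk]
        rw [whittakerCoeff_eq_zero_of_upper_invariant ν₀ hx₀ψ (leftTranslateWeight_torus_upper_invariant hU0 hθU hy)
          (f : (AdelicGroupData.gl 2 K).L2 μ) hg, enorm_zero, zero_pow two_ne_zero]
      calc _ = ∑' _ : ↥T → ℤ, ∫⁻ _ : (mixedSpace K)ˣ, (0 : ℝ≥0∞) ∂mixedUnitsHaar K := tsum_congr fun m' => lintegral_congr fun y => hzero m' y
        _ = 0 := by simp
        _ ≤ _ := bot_le
    · -- the projector shells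
      have hle : k₀ ≤ k := not_lt.1 hlt
      have hMle : D₀.N ≤ D₀.N + N₀ + k.natAbs := by omega
      have hDN : (N₀ : ℤ) + |k| ≤ (D₀.atLevel (D₀.N + N₀ + k.natAbs) hMle).N := by
        show (N₀ : ℤ) + |k| ≤ ((D₀.N + N₀ + k.natAbs : ℕ) : ℤ)
        push_cast; rw [← Int.natCast_natAbs]; omega
      have hcc' : 2 * (N₀ : ℤ) ≤ (D₀.atLevel (D₀.N + N₀ + k.natAbs) hMle).c := hcc
      have hLOK : (D₀.atLevel (D₀.N + N₀ + k.natAbs) hMle).LevelOK D₀.N := D₀.levelOK_N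
      exact shell_estimate (μ := μ) ν₀ ϖ hv hU0 (D₀.atLevel (D₀.N + N₀ + k.natAbs) hMle) hcc' hLOK hN'0 hIH W hθ hθU f hle hDN
        (valued_zpow_uniformizer hϖ k)
  -- Step 3: sum over the shells with Bessel's inequality
  have hBesselA : ∀ u, ∑' k : ℤ, ENNReal.ofReal (A k u) ≤ ENNReal.ofReal (‖x u‖ ^ 2) := fun u =>
    ENNReal.tsum_ofReal_le_of_sum_le (fun k => sq_nonneg _) fun s => sum_norm_sq_twistedAverage_torus_le D₀.hc D₀.hψ hϖ hx₀ hx₀ψ (x u) s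
  have hBesselB : ∀ u, ∑' k : ℤ, ENNReal.ofReal (B k u) ≤ ENNReal.ofReal (‖x u‖ ^ 2) := fun u =>
    ENNReal.tsum_ofReal_le_of_sum_le (fun k => sq_nonneg _) fun s => sum_norm_sq_twistedAverage_torus_le_conj D₀.hc D₀.hψ hϖ hx₀ hx₀ψ (x u) s
  calc ∑' k : ℤ, ∑' m' : ↥T → ℤ, ∫⁻ y, Φ (θk k) (archDilationGL K y * torusShellProd ϖ T m') ∂mixedUnitsHaar K
      ≤ ∑' k : ℤ, 2 * C * ∑ u ∈ 𝒰, (ENNReal.ofReal (A k u) + ENNReal.ofReal (B k u)) := ENNReal.tsum_le_tsum hshell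
    _ = 2 * C * ∑ u ∈ 𝒰, (∑' k : ℤ, ENNReal.ofReal (A k u) + ∑' k : ℤ, ENNReal.ofReal (B k u)) := by
        rw [ENNReal.tsum_mul_left, Summable.tsum_finsetSum fun _ _ => ENNReal.summable]
        congr 1
        refine Finset.sum_congr rfl fun u _ => ?_
        exact ENNReal.tsum_add
    _ ≤ 2 * C * ∑ u ∈ 𝒰, (ENNReal.ofReal (‖x u‖ ^ 2) + ENNReal.ofReal (‖x u‖ ^ 2)) :=
        mul_le_mul' le_rfl (Finset.sum_le_sum fun u _ => add_le_add (hBesselA u) (hBesselB u))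
    _ = 4 * C * ∑ u ∈ 𝒰, ENNReal.ofReal (‖x u‖ ^ 2) := by
        rw [← Finset.sum_add_distrib.symm, ← two_mul, ← mul_assoc, show (2 : ℝ≥0∞) * C * 2 = 4 * C by ring]

end Step

/-! ### The Kirillov `L²`-bound at any finite set of finite places -/

section Final

variable [MeasurableSpace (GL (Fin 2) (AdeleRing (𝓞 K) K))] [BorelSpace (GL (Fin 2) (AdeleRing (𝓞 K) K))]

omit [MeasurableSpace (GL (Fin 2) (AdeleRing (𝓞 K) K))] [BorelSpace (GL (Fin 2) (AdeleRing (𝓞 K) K))] [(AdelicGroupData.gl 2 K).IsAutomorphicMeasure μ] in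
/-- A uniformizer at every finite place. [folklore] -/
theorem exists_uniformizers : ∃ ϖ : ∀ v : HeightOneSpectrum (𝓞 K), (v.adicCompletion K)ˣ,
    ∀ v, Valued.v ((ϖ v : (v.adicCompletion K)ˣ) : v.adicCompletion K) = exp (-1 : ℤ) := by
  have h : ∀ v : HeightOneSpectrum (𝓞 K), ∃ t : (v.adicCompletion K)ˣ, Valued.v (t : v.adicCompletion K) = exp (-1 : ℤ) := by
    intro v
    obtain ⟨π, -, hπ⟩ := exists_coe_valued_eq_exp_neg_one (K := K) v
    have hπ0 : (π : v.adicCompletion K) ≠ 0 := fun h0 => by rw [h0, map_zero] at hπ; exact exp_ne_zero hπ.symm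
    exact ⟨Units.mk0 _ hπ0, by rw [Units.val_mk0]; exact hπ⟩
  choose ϖ hϖ using h
  exact ⟨ϖ, hϖ⟩

/-- **The Kirillov `L²`-bound for `GL_2` at any finite set of finite places**: for every finite `S'`
and every compact open level `U ≤ GL_2(𝔸_K^∞)` there are `C < ∞` and a finite set of archimedean words `𝒰`
such that for every closed `W ≤ L²`, every level-`U` test function `θ` and every `f ∈ W`,
`∑_{m ∈ ℤ^{S'}} ∫_{K_∞ˣ} |W_{S_θ f}(a(y) ∏_{v∈S'} ι_v(a(ϖ_v^{m_v})))|² d^×y ≤ C ∑_{u∈𝒰} ‖S_{θ_u} f‖²`.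
[cite: JacquetShalikaAJM1981, §5] [cite: Bump1997, §2.8] -/
theorem exists_kirillovL2Bound (ν₀ : Measure ↥(adelicUnipotent 2 K)) [Measure.IsHaarMeasure ν₀]
    (ϖ : ∀ v : HeightOneSpectrum (𝓞 K), (v.adicCompletion K)ˣ)
    (hϖ : ∀ v, Valued.v ((ϖ v : (v.adicCompletion K)ˣ) : v.adicCompletion K) = exp (-1 : ℤ)) :
    ∀ (S' : Finset (HeightOneSpectrum (𝓞 K))) (U : Subgroup (GL (Fin 2) (FiniteAdeleRing (𝓞 K) K))),
      IsOpen (U : Set (GL (Fin 2) (FiniteAdeleRing (𝓞 K) K))) → IsCompact (U : Set (GL (Fin 2) (FiniteAdeleRing (𝓞 K) K))) →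
      ∃ (C : ℝ≥0∞) (_ : C ≠ ⊤) (𝒰 : Finset (List (AutomorphyDatum.gl 2 K (isCompact_glFiniteIntegralLevel_holds 2 K)).arch.lie)),
        KirillovL2Bound μ ν₀ ϖ S' U C 𝒰 := by
  intro S'
  induction S' using Finset.induction_on with
  | empty => intro U hUo hUc; exact kirillovL2Bound_empty ν₀ ϖ U hUo hUc
  | insert v T hv ih =>
    intro U hUo hUc
    -- the level of `U` at `v`
    obtain ⟨N₀, hU0⟩ := exists_ofLocalFinite_localCongruenceSubgroup_le (v := v) hUo
    -- the conductor exponent of `ψ_v`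
    have hψv : ((adeleAddChar K).adicComponent v).IsContinuousNontrivial :=
      (isGlobalAddChar_adeleAddChar (K := K)).isContinuousNontrivial_adicComponent (adicComponent_adeleAddChar_ne_one v)
    obtain ⟨d, hd⟩ := hψv.exists_hasConductorExp
    -- the shell datum at `v`
    have hc1 : (1 : ℤ) ≤ max 1 (2 * (N₀ : ℤ)) := le_max_left _ _
    have hψ : ∀ x : v.adicCompletion K, Valued.v x ≤ exp ((1 - d) - max 1 (2 * (N₀ : ℤ))) → (adeleAddChar K).adicComponent v x = 1 :=
      fun x hx => hd.1 x ((mem_primePowBall_adicCompletion_iff (v := v)).2 (hx.trans (exp_le_exp.2 (by omega))))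
    have hNn : 0 ≤ |1 - d| + max 1 (2 * (N₀ : ℤ)) + N₀ := by positivity
    set N : ℕ := (|1 - d| + max 1 (2 * (N₀ : ℤ)) + N₀).toNat with hN
    have hN' : ((N : ℕ) : ℤ) = |1 - d| + max 1 (2 * (N₀ : ℤ)) + N₀ := Int.toNat_of_nonneg hNn
    have hab := le_abs_self (1 - d)
    have hab' := neg_abs_le (1 - d)
    let D₀ : ShellDatum K v := ⟨1 - d, max 1 (2 * (N₀ : ℤ)), hc1, N, by omega, by omega, by omega, by omega, hψ⟩
    -- the induction hypothesis at the deeper level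
    obtain ⟨C, hC, 𝒰, hKLB⟩ := ih (levelInfAt K v U N) (isOpen_levelAt hUo N) (isCompact_levelAt hUc N)
    refine ⟨4 * C, ENNReal.mul_ne_top (by norm_num) hC, 𝒰, ?_⟩
    exact kirillovL2Bound_insert ν₀ ϖ (hϖ v) hv hU0 hd D₀ rfl (le_max_right _ _) (by show N₀ ≤ N; omega) hKLB

end Final

end Literature.NumberTheory.Automorphic
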